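import Summits.CriticalPhenomena.PercolationContinuityZ3.Theorems.PercNearOneGluingNoHeavyLowerTailE3FourPointGammaLeSix
import Summits.CriticalPhenomena.PercolationContinuityZ3.Theorems.PercNearOneGluingNoHeavyLowerTailE3SupportTransport

/-!
# `NoHeavyLowerTail` (crux stmt-CriticalPhenomena-4575): the four-point E3GRP class `γ` on EVERY finite weighted graph whose
# Steiner part splits into blocks of at most two vertices

Support file (prover seat `prim-ineq-prove-1` gen 24; `--supports stmt-CriticalPhenomena-4575`).  No definitions, no named facts,
no sorries, no `native_decide` in this file (it inherits the computational `n ≤ 6` rung `…E3FourPointGammaLeSix`).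

`γ = E₃(U[ab|cy], U[ac|by], U[ay|bc]) ≥ 0` (`row4 6`, `GammaRow`) is the one four-point E3GRP class still open on general graphs.
Two tree facts make the finite rung `fourPointGamma_le_six` travel:
* `FourPointSplit.sahiE3_fourPointSplit_nonneg_of_terminalGluing` (prim-sahi-p2) — the class of weight vectors satisfying `γ` is
  closed under gluing two edge systems that share only the four terminals;
* `rowHolds4_transport` (`…E3SupportTransport`) — a four-point class for weights supported on the pairs of (the image of) a
  small vertex set is the same statement on the small vertex set.

Results (all `n`, all weights, pairwise distinct terminals `a b c y : Fin n`):
* `fourPointGamma_of_support_subset` — **`γ` holds whenever the positive-weight non-loop pairs all lie inside a vertex set of at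
  most six elements containing the terminals** (at most two "active" Steiner vertices).
* `fourPointGamma_of_steinerBlocks` — **`γ` holds whenever the non-terminal vertices carry labels such that equal-label classes
  have at most two non-terminal members and every pair of non-terminals with different labels has weight zero** — i.e. every
  connected component of the support graph minus the terminals has at most two vertices: any number of Steiner vertices and
  Steiner pairs hanging off the terminal set `{a, b, c, y}` (plus arbitrary terminal–terminal edges).  Induction on the labels:
  split off one block with the gluing theorem, certify it by the six-vertex rung through the transport lemma.
A minimal counterexample to `γ` therefore has a Steiner component with at least three vertices.
[cite: LiebSahi2021, eq. (2.1) (the functional E₃)]; [cite: Kahn2022, Conj. 5 (arXiv p. 3)]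
-/

namespace Summit.CriticalPhenomena.PercolationContinuityZ3.Theorems.E3GroupSepCert

open Finset MeasureTheory OneCutCert CovTransferCert
open scoped BigOperators
open Literature.Probability.Percolation Literature.Probability.LatticeModels

variable {n : ℕ}

/-! ## Support inside six vertices -/

/-- **`γ` for weights supported inside six vertices.**  If every non-loop pair of nonzero weight joins two vertices of a set `S`
with `|S| ≤ 6` containing the (pairwise distinct) terminals, then `γ` holds at `(a, b, c, y)`. [this work] -/
theorem fourPointGamma_of_support_subset (w : Sym2 (Fin n) → unitInterval) (S : Finset (Fin n)) (hS : S.card ≤ 6)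
    (hw : ∀ u v : Fin n, u ≠ v → w s(u, v) ≠ 0 → u ∈ S ∧ v ∈ S) (a b c y : Fin n) (hab : a ≠ b) (hac : a ≠ c) (hay : a ≠ y)
    (hbc : b ≠ c) (hby : b ≠ y) (hcy : c ≠ y) (ha : a ∈ S) (hb : b ∈ S) (hc : c ∈ S) (hy : y ∈ S) :
    Row4Holds 6 w (a, b, c, y) := by
  classical
  by_cases hn : n ≤ 6
  · exact fourPointGamma_le_six n hn w a b c y hab hac hay hbc hby hcy
  · rw [not_le] at hn
    obtain ⟨S', hSS', -, hS'⟩ := Finset.exists_subsuperset_card_eq (Finset.subset_univ S) hS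
      (by rw [Finset.card_univ, Fintype.card_fin]; omega)
    let e : ↥S' ≃ Fin 6 := S'.equivFinOfCardEq hS'
    let φ : Fin 6 → Fin n := fun i => (e.symm i).val
    have hφ : Function.Injective φ := fun i j h => e.symm.injective (Subtype.val_injective h)
    have hrange : ∀ u ∈ S', u ∈ Set.range φ := fun u hu => ⟨e ⟨u, hu⟩, by simp [φ]⟩
    have hw' : ∀ u v : Fin n, u ≠ v → w s(u, v) ≠ 0 → u ∈ Set.range φ ∧ v ∈ Set.range φ := fun u v huv hne =>
      ⟨hrange u (hSS' (hw u v huv hne).1), hrange v (hSS' (hw u v huv hne).2)⟩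
    have ea : φ (e ⟨a, hSS' ha⟩) = a := by simp [φ]
    have eb : φ (e ⟨b, hSS' hb⟩) = b := by simp [φ]
    have ec : φ (e ⟨c, hSS' hc⟩) = c := by simp [φ]
    have ey : φ (e ⟨y, hSS' hy⟩) = y := by simp [φ]
    have key := (rowHolds4_transport 6 hφ hw' (e ⟨a, hSS' ha⟩, e ⟨b, hSS' hb⟩, e ⟨c, hSS' hc⟩, e ⟨y, hSS' hy⟩)).2
      (rowHolds4_six_six (w ∘ Sym2.map φ) _ _ _ _
        (ne_of_apply_ne φ (by rw [ea, eb]; exact hab)) (ne_of_apply_ne φ (by rw [ea, ec]; exact hac))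
        (ne_of_apply_ne φ (by rw [ea, ey]; exact hay)) (ne_of_apply_ne φ (by rw [eb, ec]; exact hbc))
        (ne_of_apply_ne φ (by rw [eb, ey]; exact hby)) (ne_of_apply_ne φ (by rw [ec, ey]; exact hcy)))
    simp only [ea, eb, ec, ey] at key
    exact key

/-! ## Steiner blocks of size at most two -/

/-- Switching a piece of `offDiagW w` on keeps zero weights zero. [this work] -/
theorem piece_offDiagW_eq_zero {D : Finset (Sym2 (Fin n))} [DecidablePred (· ∈ D)] (w : Sym2 (Fin n) → unitInterval)
    {e : Sym2 (Fin n)} (h : w e = 0) : (if e ∈ D then offDiagW w e else 0) = 0 := by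
  split_ifs
  · unfold offDiagW
    split_ifs
    · rfl
    · exact h
  · rfl

/-- A piece weight is nonzero only on its piece. [this work] -/
theorem mem_of_piece_ne_zero {D : Finset (Sym2 (Fin n))} [DecidablePred (· ∈ D)] (w : Sym2 (Fin n) → unitInterval)
    {e : Sym2 (Fin n)} (h : (if e ∈ D then offDiagW w e else 0) ≠ 0) : e ∈ D := by
  by_contra he
  rw [if_neg he] at h
  exact h rfl

/-- **`γ` on every finite weighted graph whose Steiner part splits into blocks of at most two vertices.**  Let `a b c y` be pairwise
distinct and let `β` label the vertices so that (i) two non-terminals with different labels span a pair of weight zero and (ii) at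
most two non-terminals carry any given label.  Then `E₃(U[ab|cy], U[ac|by], U[ay|bc]) ≥ 0` (`Row4Holds 6`).  Equivalently: every
connected component of the support graph minus `{a, b, c, y}` has at most two vertices. [this work] -/
theorem fourPointGamma_of_steinerBlocks (w : Sym2 (Fin n) → unitInterval) (a b c y : Fin n) (hab : a ≠ b) (hac : a ≠ c)
    (hay : a ≠ y) (hbc : b ≠ c) (hby : b ≠ y) (hcy : c ≠ y) (β : Fin n → ℕ)
    (hblk : ∀ u v : Fin n, u ∉ ({a, b, c, y} : Finset (Fin n)) → v ∉ ({a, b, c, y} : Finset (Fin n)) → β u ≠ β v →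
      w s(u, v) = 0)
    (hcard : ∀ j, (Finset.univ.filter fun u => u ∉ ({a, b, c, y} : Finset (Fin n)) ∧ β u = j).card ≤ 2) :
    Row4Holds 6 w (a, b, c, y) := by
  classical
  set T : Finset (Fin n) := {a, b, c, y} with hT
  have hTmem : ∀ v : Fin n, v ∈ T ↔ (v = a ∨ v = b ∨ v = c ∨ v = y) := fun v => by simp [hT]
  have hTcard : T.card ≤ 4 := Finset.card_le_four
  -- induction on the set of labels whose blocks may carry weight
  suffices H : ∀ (L : Finset ℕ) (w : Sym2 (Fin n) → unitInterval),
      (∀ u v : Fin n, u ∉ T → v ∉ T → β u ≠ β v → w s(u, v) = 0) →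
      (∀ u : Fin n, u ∉ T → β u ∉ L → ∀ v : Fin n, u ≠ v → w s(u, v) = 0) → Row4Holds 6 w (a, b, c, y) by
    exact H (Finset.univ.image β) w hblk (fun u _ hu => absurd (Finset.mem_image_of_mem β (Finset.mem_univ u)) hu)
  intro L
  induction L using Finset.induction_on with
  | empty =>
    intro w hblk hiso
    refine fourPointGamma_of_support_subset w T (hTcard.trans (by norm_num)) ?_ a b c y hab hac hay hbc hby hcy
      ((hTmem a).2 (Or.inl rfl)) ((hTmem b).2 (Or.inr (Or.inl rfl))) ((hTmem c).2 (Or.inr (Or.inr (Or.inl rfl))))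
      ((hTmem y).2 (Or.inr (Or.inr (Or.inr rfl))))
    intro u v huv hne
    by_contra hnot
    rcases not_and_or.1 hnot with hu | hv
    · exact hne (hiso u hu (Finset.notMem_empty _) v huv)
    · exact hne (by rw [Sym2.eq_swap]; exact hiso v hv (Finset.notMem_empty _) u huv.symm)
  | @insert j L hj ih =>
    intro w hblk hiso
    -- the block of label `j` and the two edge systems
    set Bj : Finset (Fin n) := Finset.univ.filter fun u => u ∉ T ∧ β u = j with hBj
    have hBjmem : ∀ u : Fin n, u ∈ Bj ↔ u ∉ T ∧ β u = j := fun u => by simp [hBj]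
    have hBjcard : Bj.card ≤ 2 := hcard j
    set D₁ : Finset (Sym2 (Fin n)) :=
      Finset.univ.filter fun e => ¬ e.IsDiag ∧ (∀ v ∈ e, v ∈ Bj ∨ v ∈ T) ∧ ∃ v ∈ e, v ∈ Bj with hD₁
    set D₂ : Finset (Sym2 (Fin n)) := Finset.univ.filter fun e => ¬ e.IsDiag ∧ ∀ v ∈ e, v ∉ Bj with hD₂
    have hD₁mem : ∀ e, e ∈ D₁ ↔ ¬ e.IsDiag ∧ (∀ v ∈ e, v ∈ Bj ∨ v ∈ T) ∧ ∃ v ∈ e, v ∈ Bj := fun e => by simp [hD₁]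
    have hD₂mem : ∀ e, e ∈ D₂ ↔ ¬ e.IsDiag ∧ ∀ v ∈ e, v ∉ Bj := fun e => by simp [hD₂]
    have hD : Disjoint D₁ D₂ := by
      rw [Finset.disjoint_left]
      intro e h1 h2
      obtain ⟨v, hv, hvB⟩ := ((hD₁mem e).1 h1).2.2
      exact ((hD₂mem e).1 h2).2 v hv hvB
    have hsep : ∀ v : Fin n, ∀ e₁ ∈ D₁, ∀ e₂ ∈ D₂, v ∈ e₁ → v ∈ e₂ → (v = a ∨ v = b ∨ v = c ∨ v = y) := by
      intro v e₁ he₁ e₂ he₂ hv₁ hv₂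
      rcases ((hD₁mem e₁).1 he₁).2.1 v hv₁ with hvB | hvT
      · exact absurd hvB (((hD₂mem e₂).1 he₂).2 v hv₂)
      · exact (hTmem v).1 hvT
    have hwoff : ∀ e, e ∉ D₁ ∪ D₂ → offDiagW w e = 0 := by
      intro e he
      by_cases hd : e.IsDiag
      · exact offDiagW_of_isDiag w hd
      · rw [Finset.mem_union, not_or, hD₁mem, hD₂mem] at he
        obtain ⟨he₁, he₂⟩ := he
        -- a vertex of `e` in the block, and one outside the block and outside `T`
        have hex₀ : ∃ v₀ ∈ e, v₀ ∈ Bj := by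
          by_contra h0
          exact he₂ ⟨hd, fun v hv hvB => h0 ⟨v, hv, hvB⟩⟩
        obtain ⟨v₀, hv₀, hv₀B⟩ := hex₀
        have hex₁ : ∃ v₁ ∈ e, v₁ ∉ Bj ∧ v₁ ∉ T := by
          by_contra h1
          refine he₁ ⟨hd, fun v hv => ?_, ⟨v₀, hv₀, hv₀B⟩⟩
          by_contra h2
          rw [not_or] at h2
          exact h1 ⟨v, hv, h2.1, h2.2⟩
        obtain ⟨v₁, hv₁, hv₁B, hv₁T⟩ := hex₁
        have hne : v₀ ≠ v₁ := fun h => hv₁B (h ▸ hv₀B)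
        have he' : e = s(v₀, v₁) := (Sym2.mem_and_mem_iff hne).1 ⟨hv₀, hv₁⟩
        obtain ⟨hv₀T, hβ₀⟩ := (hBjmem v₀).1 hv₀B
        have hβ₁ : β v₁ ≠ j := fun h => hv₁B ((hBjmem v₁).2 ⟨hv₁T, h⟩)
        have hz : w e = 0 := by
          rw [he']
          exact hblk v₀ v₁ hv₀T hv₁T (by rw [hβ₀]; exact hβ₁.symm)
        unfold offDiagW
        rw [if_neg hd, hz]
    -- glue the two pieces
    rw [← rowHolds4_offDiagW_iff, rowHolds4_six_iff]
    refine FourPointSplit.sahiE3_fourPointSplit_nonneg_of_terminalGluing (offDiagW w) hD hsep hwoff ?_ ?_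
    · -- the block piece: supported inside `Bj ∪ T`, at most six vertices
      rw [← rowHolds4_six_iff]
      refine fourPointGamma_of_support_subset _ (Bj ∪ T) ?_ ?_ a b c y hab hac hay hbc hby hcy
        (Finset.mem_union_right _ ((hTmem a).2 (Or.inl rfl))) (Finset.mem_union_right _ ((hTmem b).2 (Or.inr (Or.inl rfl))))
        (Finset.mem_union_right _ ((hTmem c).2 (Or.inr (Or.inr (Or.inl rfl)))))
        (Finset.mem_union_right _ ((hTmem y).2 (Or.inr (Or.inr (Or.inr rfl)))))
      · exact (Finset.card_union_le _ _).trans (by omega)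
      · intro u v huv hne
        have hmem := ((hD₁mem _).1 (mem_of_piece_ne_zero w hne)).2.1
        rcases hmem u (Sym2.mem_mk_left u v) with h | h <;> rcases hmem v (Sym2.mem_mk_right u v) with h' | h'
        exacts [⟨Finset.mem_union_left _ h, Finset.mem_union_left _ h'⟩, ⟨Finset.mem_union_left _ h, Finset.mem_union_right _ h'⟩,
          ⟨Finset.mem_union_right _ h, Finset.mem_union_left _ h'⟩, ⟨Finset.mem_union_right _ h, Finset.mem_union_right _ h'⟩]
    · -- the rest: block `j` is now isolated, induction hypothesis
      rw [← rowHolds4_six_iff]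
      refine ih _ ?_ ?_
      · intro u v hu hv hβ
        exact piece_offDiagW_eq_zero w (hblk u v hu hv hβ)
      · intro u hu hL v huv
        by_cases hju : β u = j
        · have huB : u ∈ Bj := (hBjmem u).2 ⟨hu, hju⟩
          rw [if_neg]
          intro hmem
          exact ((hD₂mem _).1 hmem).2 u (Sym2.mem_mk_left u v) huB
        · have hL' : β u ∉ insert j L := by
            rw [Finset.mem_insert, not_or]
            exact ⟨hju, hL⟩
          exact piece_offDiagW_eq_zero w (hiso u hu hL' v huv)

/-- **`γ` with Steiner blocks of size at most two, `GammaRow` spelling.** [this work] -/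
theorem gammaRow_of_steinerBlocks (w : Sym2 (Fin n) → unitInterval) (a b c y : Fin n) (hab : a ≠ b) (hac : a ≠ c)
    (hay : a ≠ y) (hbc : b ≠ c) (hby : b ≠ y) (hcy : c ≠ y) (β : Fin n → ℕ)
    (hblk : ∀ u v : Fin n, u ∉ ({a, b, c, y} : Finset (Fin n)) → v ∉ ({a, b, c, y} : Finset (Fin n)) → β u ≠ β v →
      w s(u, v) = 0)
    (hcard : ∀ j, (Finset.univ.filter fun u => u ∉ ({a, b, c, y} : Finset (Fin n)) ∧ β u = j).card ≤ 2) :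
    0 ≤ sahiE3 (prodBernoulli w)
      {ω : BondConfig (Fin n) | ∃ x ∈ ({a, b} : Set (Fin n)), ∃ z ∈ ({c, y} : Set (Fin n)), (openGraph ω).Reachable x z}
      {ω : BondConfig (Fin n) | ∃ x ∈ ({a, c} : Set (Fin n)), ∃ z ∈ ({b, y} : Set (Fin n)), (openGraph ω).Reachable x z}
      {ω : BondConfig (Fin n) | ∃ x ∈ ({a, y} : Set (Fin n)), ∃ z ∈ ({b, c} : Set (Fin n)), (openGraph ω).Reachable x z} := by
  have h := (e3Ineq_iff_sahiE3_nonneg w _ _ _).1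
    (fourPointGamma_of_steinerBlocks w a b c y hab hac hay hbc hby hcy β hblk hcard)
  have e1 : {ω : BondConfig (Fin n) | ∃ x ∈ ({a, b} : Set (Fin n)), ∃ z ∈ ({c, y} : Set (Fin n)),
      (openGraph ω).Reachable x z} = connEvent (lnk [a, b] [c, y]) := by
    rw [connEvent_lnk]; ext ω; simp only [Set.mem_setOf_eq, Set.mem_insert_iff, Set.mem_singleton_iff, List.mem_cons,
      List.not_mem_nil, or_false]; rfl
  have e2 : {ω : BondConfig (Fin n) | ∃ x ∈ ({a, c} : Set (Fin n)), ∃ z ∈ ({b, y} : Set (Fin n)),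
      (openGraph ω).Reachable x z} = connEvent (lnk [a, c] [b, y]) := by
    rw [connEvent_lnk]; ext ω; simp only [Set.mem_setOf_eq, Set.mem_insert_iff, Set.mem_singleton_iff, List.mem_cons,
      List.not_mem_nil, or_false]; rfl
  have e3 : {ω : BondConfig (Fin n) | ∃ x ∈ ({a, y} : Set (Fin n)), ∃ z ∈ ({b, c} : Set (Fin n)),
      (openGraph ω).Reachable x z} = connEvent (lnk [a, y] [b, c]) := by
    rw [connEvent_lnk]; ext ω; simp only [Set.mem_setOf_eq, Set.mem_insert_iff, Set.mem_singleton_iff, List.mem_cons,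
      List.not_mem_nil, or_false]; rfl
  rw [e1, e2, e3]
  exact h

/-- **`γ` whenever the Steiner vertices are pairwise non-adjacent in the support**: if every pair of distinct non-terminals has
weight zero (each Steiner vertex hangs off the terminal set only; e.g. `K_{4,m}` plus terminal edges, any `m`), then
`E₃(U[ab|cy], U[ac|by], U[ay|bc]) ≥ 0`.  (Blocks of size one: label each vertex by itself.) [this work] -/
theorem fourPointGamma_of_steiner_independent (w : Sym2 (Fin n) → unitInterval) (a b c y : Fin n) (hab : a ≠ b) (hac : a ≠ c)
    (hay : a ≠ y) (hbc : b ≠ c) (hby : b ≠ y) (hcy : c ≠ y)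
    (hind : ∀ u v : Fin n, u ∉ ({a, b, c, y} : Finset (Fin n)) → v ∉ ({a, b, c, y} : Finset (Fin n)) → u ≠ v → w s(u, v) = 0) :
    Row4Holds 6 w (a, b, c, y) := by
  classical
  refine fourPointGamma_of_steinerBlocks w a b c y hab hac hay hbc hby hcy (fun u => u.val)
    (fun u v hu hv hβ => hind u v hu hv fun h => hβ (by rw [h])) fun j => ?_
  refine (Finset.card_le_one.2 fun u hu v hv => ?_).trans (by norm_num)
  rw [Finset.mem_filter] at hu hv
  exact Fin.ext (hu.2.2.trans hv.2.2.symm)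

end Summit.CriticalPhenomena.PercolationContinuityZ3.Theorems.E3GroupSepCert
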